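import Summits.BirchSwinnertonDyer.Rank1Residual.X4.CharacterTwistTransport
import Summits.BirchSwinnertonDyer.Rank1Residual.X4.NebentypusTwistModularSymbol
import HarnessLib

/-!
# Level lowering kills Kurihara numbers mod `p`, part 4e: from the COMPLEX twisted-symbol identity to the hypothesis `hsym` in `ℤ/p` — the reduction step, with the algebraicity and the period comparison as the ONLY remaining inputs (cell `b2b-bsdres`, seat additive-p4, line V80)

HONEST FRAMING (verbatim, cell `b2b-bsdres`): the goal of the cell is to DELETE the COMBINATION-SHAPED
residual classes for ALL analytic-rank `≤ 1` curves over `ℚ` — "full BSD formula for every rank `≤ 1`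
curve in class `C`" assembled STRICTLY from published theorems — so that the rank-`≤ 1` remainder
becomes exactly the CONSTRUCTION-SHAPED classes, which are TYPED (missing-input Props), NOT attempted;
this is not "finishing BSD". This file: research-route KERNEL THEOREMS (ring-hom bookkeeping over the
tree's `ratPlusSymbol` / `plusSymbol` and parts 4b–4d; no named fact, no conjecture, no definition,
nothing booked; class X4 stays CONSTRUCTION-SHAPED).

## What is proved

Part 4b's principal-series template (`plusSymbolLevelLowersAt_of_charTwistSum(_conductor)`) needs
`hsym : [r]⁺_{f_W} ≡ c₀ · ∑_{u mod m} χ(u) σ(r + u/m)` IN `ℤ/p`. Part 4d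
(`plusSymbol_charTwist1_of_even`) PROVES the identity over `ℂ`:
`plusSymbol f_W r = g(χ⁻¹)⁻¹ ∑_u χ⁻¹(u) · plusSymbol1 g (r + u/m)` for `f_W = charTwist1 g χ`. This
file is the passage from `ℂ` to `ℤ/p`, isolating EXACTLY what is still an input:

* §1 `ratCast_zmod_eq_of_den_mul_eq` — a rational `q` with `p ∤ den q` is determined in `ℤ/p` by
  `den q · x = num q`; `den_mul_eq_num_of_ratCast_eq` — an identity `(q : ℂ) = ι_ℂ(y)` for an
  INJECTIVE ring map `ι_ℂ : O → ℂ` gives `den q · y = num q` in `O`.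
* §2 **`ratPlusSymbol_zmod_eq_of_complexTwistIdentity`** (abstract `f_W`, abstract source symbol
  `σ_ℂ : ℚ → ℂ`): GIVEN (RAT) `plusSymbol f_W r = Ω_W · [r]⁺_{f_W}` with `[r]⁺ ∈ ℚ` `p`-integral
  (the tree's `ratPlusSymbol`; Manin–Drinfeld for the rational newform `f_W` + `p`-integrality),
  (ID) the complex identity `plusSymbol f_W r = c · ∑_u ι_ℂ(χ_O(u)) σ_ℂ(r + u/m)` (part 4d), (ALG)
  ALGEBRAICITY of the source symbol, `σ_ℂ(x) = Ω · ι_ℂ(s(x))` with `s : ℚ → O` for a ring `O` mapping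
  to `ℂ` injectively AND to `ℤ/p` (`ι : O → ℤ/p` — a prime `𝔭 ∣ p` of residue degree one of the
  coefficient order, localised), and (PER) the PERIOD COMPARISON `c · Ω = Ω_W · ι_ℂ(u_O)` with
  `u_O ∈ O` (`𝔭`-INTEGRALITY of the ratio `Ω_W⁻¹ c Ω`) — THEN
  `([r]⁺_{f_W} : ℤ/p) = ι(u_O) · ∑_u ι(χ_O(u)) · ι(s(r + u/m))`, i.e. part 4b's `hsym` with
  `c₀ = ι(u_O)`, `χ = ι ∘ χ_O`, `σ = ι ∘ s` (`hsym_data_of_complexTwistIdentity` packages it with the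
  composed character `ZMod m →* ZMod p`). If moreover `ι(u_O)` is NOT a unit (the ratio is not a
  `𝔭`-UNIT) the conclusion degenerates to `[r]⁺ ≡ 0` for all `r` (`ratPlusSymbol_zmod_eq_zero_of_not_isUnit`)
  — which is why the display asks for a unit.
* §3 **`ratPlusSymbol_charTwist1_zmod_eq`** — §2 with (ID) DISCHARGED by part 4d for
  `f_W = charTwist1 g χ` (`ψχ² = 1`, `χ` even, e.g. cubic): the inputs left are exactly (RAT) for
  `f_W`, (ALG) for the `Γ₁` plus symbols of `g` (with `ι_ℂ ∘ χ_O = χ⁻¹`), (PER); and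
  **`plusSymbolLevelLowersAt_charTwist1_of_conductor`** — composed with part 4b's conductor-`p`
  template: the certificate `PlusSymbolLevelLowersAt W p f_W ℓ` for `f_W = charTwist1 g χ` from
  (RAT) + (ALG) + (PER) + the `ℓ`-old identity `ι∘s = μ − χ_p(ℓ) μ∘[ℓ]` and plain Hecke relations of `μ`
  at the Kolyvagin primes (the `Γ₁` certificate — an instrument, per pair).

Nothing here asserts (RAT), (ALG) or (PER): (ALG) is Shimura 1977 / Manin–Drinfeld for newforms with
character (not in the tree for `Γ₁`), (PER) is a statement about canonical periods (Vatsal-type), (RAT)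
is the tree's named fact `ratCast_ratPlusSymbol` plus `p`-integrality. The cell's row of this shape is
11760bb1 at `p = 7`; nothing about it is proved here.

## References

* G. Shimura, *Introduction to the arithmetic theory of automorphic functions* (1971), Prop. 3.64.
  [cite: Shimura1971, Prop. 3.64]
* G. Shimura, *On the periods of modular forms*, Math. Ann. 229 (1977), Thm. 1. [cite: Shimura1977, Thm. 1]
* B. Mazur, J. Tate, J. Teitelbaum, Invent. Math. 84 (1986), §I.8. [cite: MazurTateTeitelbaum1986Invent, §I.8]
* C.-H. Kim, Amer. J. Math. 148 (2026), §1.2.2, §1.4.3. [cite: Kim2022StructureSelmer, §1.2.2 and §1.4.3]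
-/

noncomputable section

open scoped MatrixGroups ModularForm

open CongruenceSubgroup Finset

open Literature.NumberTheory.EllipticCurves Literature.NumberTheory.EllipticCurves.ModularForms
open Summit.BirchSwinnertonDyer.Rank1Residual.LevelLowering

namespace Summit.BirchSwinnertonDyer.Rank1Residual.NebentypusTwist

/-! ### §1 Rationals in `ℤ/p` and in a ring embedded in `ℂ` -/

section Reduction

variable {p : ℕ} [hp : Fact p.Prime]

/-- **A `p`-integral rational is determined in `ℤ/p` by its numerator and denominator**: if
`p ∤ den q` and `den q · x = num q` in `ℤ/p` then `x = (q : ℤ/p)` (`(q : ℤ/p) = num q / den q` in the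
field `ℤ/p`). [folklore] -/
theorem ratCast_zmod_eq_of_den_mul_eq (q : ℚ) (hq : ¬ p ∣ q.den) {x : ZMod p}
    (hx : (q.den : ZMod p) * x = (q.num : ZMod p)) : (q : ZMod p) = x := by
  have hden : (q.den : ZMod p) ≠ 0 := mt (ZMod.natCast_eq_zero_iff _ _).mp hq
  rw [Rat.cast_def, div_eq_iff hden, mul_comm, hx]

variable {O : Type*} [CommRing O]

/-- **An identity `(q : ℂ) = ι_ℂ(y)` for an injective ring map `ι_ℂ : O → ℂ` lives in `O`**:
`den q · y = num q` in `O`. [folklore] -/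
theorem den_mul_eq_num_of_ratCast_eq (ιC : O →+* ℂ) (hinj : Function.Injective ιC) (q : ℚ) {y : O}
    (hy : (q : ℂ) = ιC y) : (q.den : O) * y = (q.num : O) := by
  have hd : (q.den : ℂ) ≠ 0 := by exact_mod_cast q.den_ne_zero
  apply hinj
  rw [map_mul, map_natCast, map_intCast, ← hy, Rat.cast_def]
  field_simp

/-- **Reduction of a complex identity to `ℤ/p`**: if `(q : ℂ) = ι_ℂ(y)` with `ι_ℂ : O → ℂ` injective,
`p ∤ den q`, and `ι : O → ℤ/p` is any ring map, then `(q : ℤ/p) = ι(y)`. [folklore] -/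
theorem ratCast_zmod_eq_of_ratCast_complex_eq (ιC : O →+* ℂ) (hinj : Function.Injective ιC)
    (ι : O →+* ZMod p) (q : ℚ) (hq : ¬ p ∣ q.den) {y : O} (hy : (q : ℂ) = ιC y) :
    (q : ZMod p) = ι y := by
  refine ratCast_zmod_eq_of_den_mul_eq q hq ?_
  have h := congrArg ι (den_mul_eq_num_of_ratCast_eq ιC hinj q hy)
  rwa [map_mul, map_natCast, map_intCast] at h

end Reduction

/-! ### §2 From the complex twisted-symbol identity to `hsym` (abstract `f_W`, abstract source symbol) -/

section Abstract

variable {p : ℕ} [hp : Fact p.Prime] {O : Type*} [CommRing O] (ιC : O →+* ℂ) (ι : O →+* ZMod p)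
  {m : ℕ} [NeZero m] (χO : ZMod m →* O) (s : ℚ → O) (uO : O)
  {NW : ℕ} (fW : CuspForm (Gamma0 NW) 2)

/-- **FROM `ℂ` TO `ℤ/p`.** Data: an injective ring map `ι_ℂ : O → ℂ` and a ring map `ι : O → ℤ/p`;
an `O`-valued character `χ_O` mod `m`, an `O`-valued function `s` on `ℚ`, an element `u_O ∈ O`;
complex numbers `Ω_W ≠ 0`, `Ω`, `c` and a complex source symbol `σ_ℂ`. Hypotheses:
(RAT) `plusSymbol f_W r = Ω_W · [r]⁺_{f_W}` with `p ∤ den [r]⁺_{f_W}` for all `r`;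
(ID) `plusSymbol f_W r = c · ∑_{u mod m} ι_ℂ(χ_O u) · σ_ℂ(r + u/m)` (part 4d's shape);
(ALG) `σ_ℂ(x) = Ω · ι_ℂ(s x)`; (PER) `c · Ω = Ω_W · ι_ℂ(u_O)`. THEN for every `r`,
`([r]⁺_{f_W} : ℤ/p) = ι(u_O) · ∑_{u mod m} ι(χ_O u) · ι(s(r + u/m))`.
Proof: `Ω_W [r]⁺ = c ∑ ι_ℂ(χ_O u) Ω ι_ℂ(s ·) = Ω_W ι_ℂ(u_O ∑ χ_O(u) s(·))`, cancel `Ω_W`, the rational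
`[r]⁺` equals `ι_ℂ` of an element of `O`, reduce by §1.
[cite: MazurTateTeitelbaum1986Invent, §I.8] [cite: Shimura1977, Thm. 1] -/
theorem ratPlusSymbol_zmod_eq_of_complexTwistIdentity (hinj : Function.Injective ιC)
    {ΩW Ω c : ℂ} (hΩW : ΩW ≠ 0) {σC : ℚ → ℂ}
    (hrat : ∀ r : ℚ, plusSymbol fW r = ΩW * ((ratPlusSymbol fW r : ℚ) : ℂ))
    (hden : ∀ r : ℚ, ¬ p ∣ (ratPlusSymbol fW r).den)
    (hid : ∀ r : ℚ, plusSymbol fW r = c * ∑ u : ZMod m, ιC (χO u) * σC (r + twistShift u))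
    (halg : ∀ x : ℚ, σC x = Ω * ιC (s x)) (hper : c * Ω = ΩW * ιC uO) (r : ℚ) :
    ((ratPlusSymbol fW r : ℚ) : ZMod p) =
      ι uO * ∑ u : ZMod m, ι (χO u) * ι (s (r + (u.val : ℚ) / m)) := by
  -- the element of `O` behind `[r]⁺`
  set y : O := uO * ∑ u : ZMod m, χO u * s (r + (u.val : ℚ) / m) with hy
  have hshift : ∀ u : ZMod m, r + twistShift u = r + (u.val : ℚ) / m := fun u ↦ by rw [twistShift]
  have hC : ((ratPlusSymbol fW r : ℚ) : ℂ) = ιC y := by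
    have h1 : plusSymbol fW r = ΩW * ιC y := by
      rw [hid r, hy, map_mul, ← mul_assoc, ← hper, mul_assoc]
      congr 1
      rw [map_sum, Finset.mul_sum]
      refine Finset.sum_congr rfl fun u _ ↦ ?_
      rw [hshift u, halg, map_mul]
      ring
    rw [hrat r] at h1
    exact mul_left_cancel₀ hΩW h1
  rw [ratCast_zmod_eq_of_ratCast_complex_eq ιC hinj ι _ (hden r) hC, hy, map_mul, map_sum]
  congr 1
  exact Finset.sum_congr rfl fun u _ ↦ by rw [map_mul]

/-- The same conclusion PACKAGED in part 4b's vocabulary: the composed character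
`χ_p = ι ∘ χ_O : ℤ/m →* ℤ/p`, the reduced source symbol `σ = ι ∘ s : ℚ → ℤ/p`, the constant
`c₀ = ι(u_O)` — `[r]⁺_{f_W} ≡ c₀ · ∑_u χ_p(u) σ(r + u/m)`, literally the hypothesis `hsym` of
`plusSymbolLevelLowersAt_of_charTwistSum`. [cite: Kim2022StructureSelmer, §1.2.2 and §1.4.3] -/
theorem hsym_data_of_complexTwistIdentity (hinj : Function.Injective ιC)
    {ΩW Ω c : ℂ} (hΩW : ΩW ≠ 0) {σC : ℚ → ℂ}
    (hrat : ∀ r : ℚ, plusSymbol fW r = ΩW * ((ratPlusSymbol fW r : ℚ) : ℂ))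
    (hden : ∀ r : ℚ, ¬ p ∣ (ratPlusSymbol fW r).den)
    (hid : ∀ r : ℚ, plusSymbol fW r = c * ∑ u : ZMod m, ιC (χO u) * σC (r + twistShift u))
    (halg : ∀ x : ℚ, σC x = Ω * ιC (s x)) (hper : c * Ω = ΩW * ιC uO) :
    ∀ r : ℚ, ((ratPlusSymbol fW r : ℚ) : ZMod p) =
      ι uO * ∑ u : ZMod m, ((ι : O →* ZMod p).comp χO) u * (ι ∘ s) (r + (u.val : ℚ) / m) := by
  intro r
  rw [ratPlusSymbol_zmod_eq_of_complexTwistIdentity ιC ι χO s uO fW hinj hΩW hrat hden hid halg hper r]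
  rfl

/-- **Why the display asks for a UNIT**: if the reduced comparison constant `c₀ = ι(u_O)` is NOT a unit of
the field `ℤ/p` (i.e. `c₀ = 0`: the ratio `Ω_W⁻¹ c Ω` has positive `𝔭`-valuation), the identity
degenerates to `[r]⁺_{f_W} ≡ 0 (mod p)` for every `r` — incompatible with a residually irreducible
`W[p]` (the plus symbol of `f_W` is not identically `0` mod `p`), so in every honest instance `c₀` is a
unit. [folklore] -/
theorem ratPlusSymbol_zmod_eq_zero_of_not_isUnit (hinj : Function.Injective ιC)
    {ΩW Ω c : ℂ} (hΩW : ΩW ≠ 0) {σC : ℚ → ℂ}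
    (hrat : ∀ r : ℚ, plusSymbol fW r = ΩW * ((ratPlusSymbol fW r : ℚ) : ℂ))
    (hden : ∀ r : ℚ, ¬ p ∣ (ratPlusSymbol fW r).den)
    (hid : ∀ r : ℚ, plusSymbol fW r = c * ∑ u : ZMod m, ιC (χO u) * σC (r + twistShift u))
    (halg : ∀ x : ℚ, σC x = Ω * ιC (s x)) (hper : c * Ω = ΩW * ιC uO)
    (hnu : ¬ IsUnit (ι uO)) (r : ℚ) :
    ((ratPlusSymbol fW r : ℚ) : ZMod p) = 0 := by
  have h0 : ι uO = 0 := by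
    by_contra h
    exact hnu (Ne.isUnit h)
  rw [ratPlusSymbol_zmod_eq_of_complexTwistIdentity ιC ι χO s uO fW hinj hΩW hrat hden hid halg hper r,
    h0, zero_mul]

end Abstract

/-! ### §3 The principal-series row: (ID) discharged by part 4d, composed with part 4b's conductor-`p` template -/

section Descended

variable {p : ℕ} [hp : Fact p.Prime] {O : Type*} [CommRing O] (ιC : O →+* ℂ) (ι : O →+* ZMod p)
  {N : ℕ} [NeZero N] {m : ℕ} [NeZero m] (L : ℕ) [NeZero L]
  (χO : ZMod m →* O) (s : ℚ → O) (uO : O)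

/-- **`hsym` FOR THE DESCENDED TWIST `f_W = charTwist1 g χ`** (`g ∈ S₂(N, ψ)`, `χ mod m` even with
`ψχ² = 1` mod `L`; e.g. `χ` cubic): the complex identity (ID) is part 4d's
`plusSymbol_charTwist1_of_even` (`c = g(χ⁻¹)⁻¹`, source symbol `plusSymbol1 g`, character `χ⁻¹`), so
the inputs left are (RAT) for `f_W`, (ALG) `plusSymbol1 g x = Ω · ι_ℂ(s x)` with an `O`-valued lift
`χ_O` of `χ⁻¹` (`ι_ℂ ∘ χ_O = χ⁻¹`), and (PER) `g(χ⁻¹)⁻¹ · Ω = Ω_W · ι_ℂ(u_O)`: THEN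
`([r]⁺_{f_W} : ℤ/p) = ι(u_O) · ∑_u ι(χ_O u) · ι(s(r + u/m))` for every `r`.
[cite: Shimura1971, Prop. 3.64] [cite: Shimura1977, Thm. 1] [cite: MazurTateTeitelbaum1986Invent, §I.8] -/
theorem ratPlusSymbol_charTwist1_zmod_eq (hN : N ∣ L) (hm : m ^ 2 ∣ L) (hNm : N * m ∣ L) (hmL : m ∣ L)
    {ψ : DirichletCharacter ℂ N} {g : CuspForm (Gamma1 N) 2} (hg : g ∈ nebentypusSubspace N 2 ψ)
    {χ : DirichletCharacter ℂ m}
    (hψχ : DirichletCharacter.changeLevel hN ψ * DirichletCharacter.changeLevel hmL χ ^ 2 = 1)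
    (hχe : χ.Even) (hinj : Function.Injective ιC) (hχO : ∀ u : ZMod m, ιC (χO u) = χ⁻¹ u)
    {ΩW Ω : ℂ} (hΩW : ΩW ≠ 0)
    (hrat : ∀ r : ℚ, plusSymbol (charTwist1 L hN hm hNm hmL hg hψχ) r =
      ΩW * ((ratPlusSymbol (charTwist1 L hN hm hNm hmL hg hψχ) r : ℚ) : ℂ))
    (hden : ∀ r : ℚ, ¬ p ∣ (ratPlusSymbol (charTwist1 L hN hm hNm hmL hg hψχ) r).den)
    (halg : ∀ x : ℚ, plusSymbol1 g x = Ω * ιC (s x))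
    (hper : (gaussSum χ⁻¹ (ZMod.stdAddChar (N := m)))⁻¹ * Ω = ΩW * ιC uO) (r : ℚ) :
    ((ratPlusSymbol (charTwist1 L hN hm hNm hmL hg hψχ) r : ℚ) : ZMod p) =
      ι uO * ∑ u : ZMod m, ι (χO u) * ι (s (r + (u.val : ℚ) / m)) := by
  refine ratPlusSymbol_zmod_eq_of_complexTwistIdentity ιC ι χO s uO _ hinj hΩW hrat hden
    (fun r' ↦ ?_) halg hper r
  rw [plusSymbol_charTwist1_of_even L hN hm hNm hmL hg hψχ hχe r']
  exact congrArg _ (Finset.sum_congr rfl fun u _ ↦ by rw [hχO u])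

variable (W : WeierstrassCurve ℚ) [W.IsGloballyMinimal]

/-- **THE PRINCIPAL-SERIES ROW'S CERTIFICATE FROM (RAT) + (ALG) + (PER) + THE `Γ₁` CERTIFICATE.**
Conductor-`p` case (`m = p`, `ι ∘ χ_O =: χ_p : ℤ/p →* ℤ/p`): for `f_W = charTwist1 g χ` as above,
(RAT) + (ALG) + (PER) give `hsym` with `c₀ = ι(u_O)`, `σ = ι ∘ s` (this file); part 4b's
`plusSymbolLevelLowersAt_of_charTwistSum_conductor` then turns an `ℓ`-old identity
`ι(s r) = μ r − χ_p(ℓ) μ(ℓ r)` for a periodic `μ` plainly `T_q`-eigen with eigenvalue `a_q(W)` at the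
Kolyvagin primes of `(W, p)` (the `Γ₁` level-lowering certificate of the source — an instrument, per
pair) into `PlusSymbolLevelLowersAt W p f_W ℓ`, whence every consequence of parts 1–3 (Kurihara
numbers of `f_W` vanish mod `p`, `∂^{(∞)} ≥ 1`). Nothing asserts the hypotheses.
[cite: Kim2022StructureSelmer, §1.2.2 and §1.4.3] [cite: Shimura1971, Prop. 3.64] -/
theorem plusSymbolLevelLowersAt_charTwist1_of_conductor
    (ιp : O →+* ZMod p) (χOp : ZMod p →* O) (sp : ℚ → O) (uOp : O)
    {Lp : ℕ} [NeZero Lp] (hN : N ∣ Lp) (hm : p ^ 2 ∣ Lp) (hNm : N * p ∣ Lp) (hmL : p ∣ Lp)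
    {ψ : DirichletCharacter ℂ N} {g : CuspForm (Gamma1 N) 2} (hg : g ∈ nebentypusSubspace N 2 ψ)
    {χ : DirichletCharacter ℂ p}
    (hψχ : DirichletCharacter.changeLevel hN ψ * DirichletCharacter.changeLevel hmL χ ^ 2 = 1)
    (hχe : χ.Even) (hinj : Function.Injective ιC) (hχO : ∀ u : ZMod p, ιC (χOp u) = χ⁻¹ u)
    {ΩW Ω : ℂ} (hΩW : ΩW ≠ 0)
    (hrat : ∀ r : ℚ, plusSymbol (charTwist1 Lp hN hm hNm hmL hg hψχ) r =
      ΩW * ((ratPlusSymbol (charTwist1 Lp hN hm hNm hmL hg hψχ) r : ℚ) : ℂ))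
    (hden : ∀ r : ℚ, ¬ p ∣ (ratPlusSymbol (charTwist1 Lp hN hm hNm hmL hg hψχ) r).den)
    (halg : ∀ x : ℚ, plusSymbol1 g x = Ω * ιC (sp x))
    (hper : (gaussSum χ⁻¹ (ZMod.stdAddChar (N := p)))⁻¹ * Ω = ΩW * ιC uOp)
    {μ : ℚ → ZMod p} (hμ : IsPeriodic μ) {ℓ : ℕ} (hℓ : ¬ p ∣ ℓ)
    (hV : ∀ r : ℚ, ιp (sp r) = μ r - ((ιp : O →* ZMod p).comp χOp) ℓ * μ (ℓ * r))
    (hH : ∀ q : ℕ, Kato.IsKolyvaginPrime W p 1 q → HeckeRel μ q (W.frobeniusTrace q : ZMod p)) :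
    PlusSymbolLevelLowersAt W p (charTwist1 Lp hN hm hNm hmL hg hψχ) ℓ := by
  refine plusSymbolLevelLowersAt_of_charTwistSum_conductor W p ((ιp : O →* ZMod p).comp χOp)
    (charTwist1 Lp hN hm hNm hmL hg hψχ) (ιp uOp) (σ := ιp ∘ sp) (fun r ↦ ?_) hμ hℓ
    (fun r ↦ hV r) rfl hH
  rw [ratPlusSymbol_charTwist1_zmod_eq ιC ιp Lp χOp sp uOp hN hm hNm hmL hg hψχ hχe hinj hχO hΩW
    hrat hden halg hper r]
  rfl

end Descended

end Summit.BirchSwinnertonDyer.Rank1Residual.NebentypusTwist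

end
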